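import Mathlib
import Summits.ValiantsHypothesis.ValiantsHypothesis.Theorems.NewtonTauWeak.Negative.Zonogon

/-!
# `NewtonUnitEquationsNewtonTauWeakHexagonTransfer` — transfer of binomial sums along injective linear maps

Rung toward `stub_binomialNewtonTauCommon` (T2 = KPTT Conj. 1 at `t = 2`; crux `NewtonTauWeak`,
stmt-ValiantsHypothesis-5904), line `binomial-normal-form`, lead c3.

`hex_vert_transfer`: if an injective real-linear map `L` of the plane carries each common exponent `d_j` to
`d'_j`, then the binomial sums `Σ_l c_l Π_j (1 - ρ_{lj} X^{d_j})` and `Σ_l c_l Π_j (1 - ρ_{lj} X^{d'_j})` have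
the same number of Newton vertices.  Indeed both expand as `Σ_J T(J) X^{d_J}` with the SAME word weights
`T(J) = Σ_l c_l Π_{j∈J} (-ρ_{lj})`; `L` (injective, additive) matches the coincidence patterns
`d_J = d_{J'} ↔ d'_J = d'_{J'}`, so the coefficient at `d_J` equals the coefficient at `d'_J`, the embedded
supports correspond under `L`, and a linear automorphism of `ℝ²` preserves convex hulls and extreme points
(`LinearMap.image_convexHull`, `image_extremePoints`).  Use: reduce exponent lists on arbitrary lines through the
origin to the model rays `(1,0)`, `(0,1)`, `(1,1)` of `hex_binomialCommon_three_rays`. [folklore]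
-/

set_option linter.dupNamespace false

noncomputable section

namespace Summit.ValiantsHypothesis.ValiantsHypothesis.Theorems.NewtonUnitEquationsNewtonTauWeak

open scoped BigOperators
open MvPolynomial
open Summit.ValiantsHypothesis.ValiantsHypothesis.Theorems.NewtonTauWeak.Negative (vert)

namespace HexagonTransfer

/-- The real embedding of exponents. [folklore] -/
theorem emb_injective' :
    Function.Injective (fun e : Fin 2 →₀ ℕ => fun i : Fin 2 => ((e i : ℕ) : ℝ)) := by
  intro a b h
  ext i
  have hi : ((a i : ℕ) : ℝ) = ((b i : ℕ) : ℝ) := congrFun h i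
  exact_mod_cast hi

/-- The embedding is additive. [folklore] -/
theorem emb_add (a b : Fin 2 →₀ ℕ) :
    (fun i : Fin 2 => (((a + b) i : ℕ) : ℝ)) =
      (fun i : Fin 2 => ((a i : ℕ) : ℝ)) + fun i : Fin 2 => ((b i : ℕ) : ℝ) := by
  funext i
  simp [Finsupp.add_apply, Nat.cast_add]

/-- The embedding of a finite sum of exponents. [folklore] -/
theorem emb_sum {ι : Type*} (s : Finset ι) (d : ι → (Fin 2 →₀ ℕ)) :
    (fun i : Fin 2 => (((∑ j ∈ s, d j) i : ℕ) : ℝ)) = ∑ j ∈ s, fun i : Fin 2 => ((d j i : ℕ) : ℝ) := by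
  classical
  induction s using Finset.induction_on with
  | empty => funext i; simp
  | insert a s ha ih => rw [Finset.sum_insert ha, Finset.sum_insert ha, emb_add, ih]

/-- **Expansion of a binomial sum**: `Σ_l c_l Π_j (1 - ρ_{lj} X^{d_j}) = Σ_{J} X^{d_J} · T(J)` with
`T(J) = Σ_l c_l Π_{j∈J} (-ρ_{lj})`. [folklore] -/
theorem binomialSum_eq {K N : ℕ} (c : Fin K → ℂ) (ρ : Fin K → Fin N → ℂ) (d : Fin N → (Fin 2 →₀ ℕ)) :
    (∑ l, C (c l) * ∏ j, (1 - C (ρ l j) * monomial (d j) 1)) =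
      ∑ J ∈ (Finset.univ : Finset (Fin N)).powerset,
        monomial (∑ j ∈ J, d j) (∑ l, c l * ∏ j ∈ J, (-ρ l j)) := by
  classical
  have hprod : ∀ l, (∏ j, (1 - C (ρ l j) * monomial (d j) 1) : MvPolynomial (Fin 2) ℂ) =
      ∑ J ∈ (Finset.univ : Finset (Fin N)).powerset, monomial (∑ j ∈ J, d j) (∏ j ∈ J, (-ρ l j)) := by
    intro l
    have h1 : ∀ j, (1 - C (ρ l j) * monomial (d j) 1 : MvPolynomial (Fin 2) ℂ) =
        monomial (d j) (-ρ l j) + 1 := by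
      intro j
      rw [C_mul_monomial, mul_one, map_neg]
      ring
    simp_rw [h1]
    rw [Finset.prod_add]
    refine Finset.sum_congr rfl fun J _ => ?_
    rw [Finset.prod_const_one, mul_one, monomial_sum_prod]
  simp_rw [hprod, Finset.mul_sum, C_mul_monomial]
  rw [Finset.sum_comm]
  refine Finset.sum_congr rfl fun J _ => ?_
  rw [← map_sum]

/-- Coefficients of a binomial sum: the sum of the word weights over the fibre of the subset-sum map.
[folklore] -/
theorem coeff_binomialSum {K N : ℕ} (c : Fin K → ℂ) (ρ : Fin K → Fin N → ℂ) (d : Fin N → (Fin 2 →₀ ℕ))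
    (p : Fin 2 →₀ ℕ) :
    coeff p (∑ l, C (c l) * ∏ j, (1 - C (ρ l j) * monomial (d j) 1)) =
      ∑ J ∈ (Finset.univ : Finset (Fin N)).powerset,
        if (∑ j ∈ J, d j) = p then (∑ l, c l * ∏ j ∈ J, (-ρ l j)) else 0 := by
  classical
  rw [binomialSum_eq, coeff_sum]
  refine Finset.sum_congr rfl fun J _ => ?_
  rw [coeff_monomial]

/-- A support exponent of a binomial sum is a subset sum. [folklore] -/
theorem exists_word_of_mem_support {K N : ℕ} (c : Fin K → ℂ) (ρ : Fin K → Fin N → ℂ)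
    (d : Fin N → (Fin 2 →₀ ℕ)) {p : Fin 2 →₀ ℕ}
    (hp : p ∈ (∑ l, C (c l) * ∏ j, (1 - C (ρ l j) * monomial (d j) 1)).support) :
    ∃ J : Finset (Fin N), (∑ j ∈ J, d j) = p := by
  classical
  rw [mem_support_iff, coeff_binomialSum] at hp
  by_contra h
  push Not at h
  exact hp (Finset.sum_eq_zero fun J _ => if_neg (h J))

end HexagonTransfer

open HexagonTransfer

/-- **Transfer.** If an injective real-linear map of the plane carries the exponents `d_j` to the exponents
`d'_j`, the binomial sums over `d` and over `d'` have the same number of Newton vertices. [folklore] -/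
theorem hex_vert_transfer (K N : ℕ) (c : Fin K → ℂ) (ρ : Fin K → Fin N → ℂ) (d d' : Fin N → (Fin 2 →₀ ℕ))
    (L : (Fin 2 → ℝ) →ₗ[ℝ] (Fin 2 → ℝ)) (hL : Function.Injective L)
    (hLd : ∀ j, L (fun i : Fin 2 => ((d j i : ℕ) : ℝ)) = fun i : Fin 2 => ((d' j i : ℕ) : ℝ)) :
    vert (∑ l, C (c l) * ∏ j, (1 - C (ρ l j) * monomial (d j) 1)) =
      vert (∑ l, C (c l) * ∏ j, (1 - C (ρ l j) * monomial (d' j) 1)) := by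
  classical
  set emb : (Fin 2 →₀ ℕ) → (Fin 2 → ℝ) := fun e i => ((e i : ℕ) : ℝ) with hemb
  set f := ∑ l, C (c l) * ∏ j, (1 - C (ρ l j) * monomial (d j) 1) with hf
  set f' := ∑ l, C (c l) * ∏ j, (1 - C (ρ l j) * monomial (d' j) 1) with hf'
  -- `L` carries subset sums to subset sums
  have hLJ : ∀ J : Finset (Fin N), L (emb (∑ j ∈ J, d j)) = emb (∑ j ∈ J, d' j) := by
    intro J
    simp only [hemb]
    rw [emb_sum, emb_sum, map_sum]
    exact Finset.sum_congr rfl fun j _ => hLd j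
  -- coincidence patterns agree
  have hco : ∀ J J' : Finset (Fin N), (∑ j ∈ J, d j) = (∑ j ∈ J', d j) ↔
      (∑ j ∈ J, d' j) = (∑ j ∈ J', d' j) := by
    intro J J'
    constructor
    · intro h
      apply emb_injective'
      change emb (∑ j ∈ J, d' j) = emb (∑ j ∈ J', d' j)
      rw [← hLJ, ← hLJ, h]
    · intro h
      apply emb_injective'
      apply hL
      change L (emb (∑ j ∈ J, d j)) = L (emb (∑ j ∈ J', d j))
      rw [hLJ, hLJ, h]
  -- coefficients at corresponding subset sums agree
  have hcoeff : ∀ J₀ : Finset (Fin N), coeff (∑ j ∈ J₀, d j) f = coeff (∑ j ∈ J₀, d' j) f' := by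
    intro J₀
    rw [hf, hf', coeff_binomialSum, coeff_binomialSum]
    refine Finset.sum_congr rfl fun J _ => ?_
    by_cases h : (∑ j ∈ J, d j) = ∑ j ∈ J₀, d j
    · rw [if_pos h, if_pos ((hco J J₀).mp h)]
    · rw [if_neg h, if_neg (fun h' => h ((hco J J₀).mpr h'))]
  -- the embedded supports correspond under `L`
  have himage : emb '' (f'.support : Set (Fin 2 →₀ ℕ)) = L '' (emb '' (f.support : Set (Fin 2 →₀ ℕ))) := by
    ext x
    constructor
    · rintro ⟨p', hp', rfl⟩
      obtain ⟨J, rfl⟩ := exists_word_of_mem_support c ρ d' (Finset.mem_coe.mp hp')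
      refine ⟨emb (∑ j ∈ J, d j), ⟨_, ?_, rfl⟩, hLJ J⟩
      rw [Finset.mem_coe, mem_support_iff, hcoeff J]
      exact mem_support_iff.mp (Finset.mem_coe.mp hp')
    · rintro ⟨_, ⟨p, hp, rfl⟩, rfl⟩
      obtain ⟨J, rfl⟩ := exists_word_of_mem_support c ρ d (Finset.mem_coe.mp hp)
      refine ⟨∑ j ∈ J, d' j, ?_, (hLJ J).symm⟩
      rw [Finset.mem_coe, mem_support_iff, ← hcoeff J]
      exact mem_support_iff.mp (Finset.mem_coe.mp hp)
  -- a linear automorphism preserves hulls, extreme points and cardinalities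
  set Le : (Fin 2 → ℝ) ≃ₗ[ℝ] (Fin 2 → ℝ) := LinearEquiv.ofInjectiveEndo L hL with hLe
  have hLe' : (Le : (Fin 2 → ℝ) → (Fin 2 → ℝ)) = L := LinearEquiv.coe_ofInjectiveEndo L hL
  unfold vert
  change (Set.extremePoints ℝ (convexHull ℝ (emb '' (f.support : Set (Fin 2 →₀ ℕ))))).ncard =
    (Set.extremePoints ℝ (convexHull ℝ (emb '' (f'.support : Set (Fin 2 →₀ ℕ))))).ncard
  have hconv : ∀ S : Set (Fin 2 → ℝ), (Le : (Fin 2 → ℝ) → (Fin 2 → ℝ)) '' convexHull ℝ S =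
      convexHull ℝ ((Le : (Fin 2 → ℝ) → (Fin 2 → ℝ)) '' S) := fun S => by
    have h := (Le : (Fin 2 → ℝ) →ₗ[ℝ] (Fin 2 → ℝ)).image_convexHull S
    simpa only [LinearEquiv.coe_coe] using h
  rw [himage, ← hLe', ← hconv, ← image_extremePoints, Set.ncard_image_of_injective _ Le.injective]

end Summit.ValiantsHypothesis.ValiantsHypothesis.Theorems.NewtonUnitEquationsNewtonTauWeak

end
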